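import Summits.NavierStokesRegularity.NavierStokesRegularity.Theorems.PerpetualPumpAveragedTypeIBlowupPreviousPairDump
import Summits.NavierStokesRegularity.NavierStokesRegularity.Theorems.PerpetualPumpAveragedTypeIBlowupPreviousPairCarrier

/-!
# Crux `PerpetualPump.AveragedTypeIBlowup` (stmt-NavierStokesRegularity-1835), line `Sketch`:
# stub `previousPair` — a priori estimates inside the bootstrap tube, V (relaxation)

Continuation of `…PreviousPairDump` and `…PreviousPairCarrier` (same section variables). With the Duhamel bound
`|bp(σ) - e^{-κσ}(bp(0) - I₁(σ))| ≤ 7/125`: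

* `prevPair_Q_lower` — the dump is complete by `σI`: `q³B - 26/25 ≤ (2B+9) κ∫₀^{σI} wp²`;
* `prevPair_bp_after` — `bp ≤ 19/100` on `[σI, s]`;
* `prevPair_bp_lower` — `-3/10 ≤ bp` on `[0, s]` (split of the weighted dump at `σd = 30/B`);
* `prevPair_wp_after` — the SHARP bond bound `wp² ≤ ω²/4` on `[σI, s]` (restart of
  `previousPair_sq_le` at `σI` with rate `≥ 31/100`; registered sub-goal `stub_prevPairRelax`).

The bootstrap is closed in `…PreviousPair`.

Reference: T. Tao, J. Amer. Math. Soc. 29 (2016), §5–6; folklore ODE calculus.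
-/

noncomputable section

-- the summit namespace `…NavierStokesRegularity.NavierStokesRegularity…` is the tree convention
set_option linter.dupNamespace false
-- every lemma of this file lives inside one `variable … include` context (the bootstrap tube);
-- not every lemma uses every bundled hypothesis
set_option linter.unusedSectionVars false

open MeasureTheory Set Filter Topology

namespace Summit.NavierStokesRegularity.NavierStokesRegularity.Theorems.PerpetualPumpAveragedTypeIBlowup

section Tube

variable {bp wp b m0 m1 wl e0 e1 : ℝ → ℝ} {B Λ κ q θ η εb ω μ σI T s : ℝ}

variable (hκq : 4 / 5 ≤ κ ∧ κ ≤ 1 ∧ 1 ≤ q ∧ q ≤ 21 / 20)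
  (hsm : 0 ≤ η ∧ 0 < εb ∧ 10 * εb ≤ ω ∧ ω ≤ 1 / 100 ∧ 0 ≤ μ ∧
    η * (μ + 2 * Real.sqrt B) ≤ ω / 10 ∧ η * μ ≤ 1 / 20 ∧ 1 / 2 ≤ θ ∧ θ ≤ 1)
  (hBT : 1000 ≤ B ∧ 0 < σI ∧ σI ≤ 3 ∧ 0 < T ∧ T ≤ 10)
  (hΛ : 100 ≤ Λ ∧ Λ ≤ B * (1 - Real.exp (-σI)) ∧
    11 * Real.sqrt B * Real.exp (-(κ * Λ / 3)) ≤ ω)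
  (hcont : ContinuousOn bp (Icc 0 T) ∧ ContinuousOn wp (Icc 0 T) ∧ ContinuousOn b (Icc 0 T) ∧
    ContinuousOn m0 (Icc 0 T) ∧ ContinuousOn m1 (Icc 0 T) ∧ ContinuousOn wl (Icc 0 T) ∧
    ContinuousOn e0 (Icc 0 T) ∧ ContinuousOn e1 (Icc 0 T))
  (hode : (∀ σ ∈ Ioo 0 T, HasDerivAt bp
      (κ * (-(bp σ) - (wp σ) ^ 2 + (wl σ) ^ 2 - εb * bp σ * wp σ) + e0 σ) σ) ∧
    (∀ σ ∈ Ioo 0 T, HasDerivAt wp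
      (κ * (wp σ * (bp σ - b σ / q - 1) + εb * (bp σ) ^ 2) + e1 σ) σ))
  (herr : (∀ σ ∈ Icc 0 T, |e0 σ| ≤ η * κ * m0 σ) ∧ (∀ σ ∈ Icc 0 T, |e1 σ| ≤ η * κ * m1 σ) ∧
    (∀ σ ∈ Icc 0 T, 0 ≤ m0 σ ∧ m0 σ ≤ m0 0 * Real.exp (-(θ * κ * σ)) +
      κ * ∫ u in (0 : ℝ)..σ, Real.exp (-(θ * κ * (σ - u))) *
        |-(wp u) ^ 2 + (wl u) ^ 2 - εb * bp u * wp u|) ∧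
    (∀ σ ∈ Icc 0 T, 0 ≤ m1 σ ∧ m1 σ ≤ m1 0 * Real.exp (-(θ * κ * σ)) +
      κ * ∫ u in (0 : ℝ)..σ, Real.exp (-(θ * κ * (σ - u))) *
        |wp u * (bp u - b u / q) + εb * (bp u) ^ 2|))
  (henv : (∀ σ ∈ Icc 0 T, |wl σ| ≤ ω) ∧
    (∀ σ ∈ Icc 0 (min T σI), B * Real.exp (-σ) - 3 ≤ b σ) ∧
    (∀ σ ∈ Icc 0 T, -(1 / 2) ≤ b σ ∧ b σ ≤ B + 3))
  (hini : q ^ 4 / 2 - 3 / 20 ≤ bp 0 ∧ bp 0 ≤ q ^ 4 / 2 + 1 / 10 ∧ 0 ≤ wp 0 ∧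
    q ^ 3 * B - 1 ≤ (wp 0) ^ 2 ∧ (wp 0) ^ 2 ≤ q ^ 3 * B + 1 ∧ m0 0 ≤ μ ∧ m1 0 ≤ μ)
  (hs : s ∈ Icc 0 T)
  (hT : ∀ σ ∈ Icc 0 s, -(1 / 2) ≤ bp σ ∧ bp σ ≤ 9 / 10 ∧ (σ ≤ σI ∨ bp σ ≤ 2 / 5) ∧
    m1 σ ≤ μ + 3 * Real.sqrt B ∧ κ * ∫ u in (0 : ℝ)..σ, (wp u) ^ 2 ≤ 1)

include hκq hsm hBT hΛ hcont hode herr henv hini hs hT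

/-- **The dump is complete by `σI`.** `q³B - 26/25 ≤ (2B + 9) κ∫₀^{σI} wp²` (energy identity with
`R ≤ B + 9/2`, `wp(0)² ≥ q³B - 1`, `wp(σI)² ≤ ω²/100`). [folklore] -/
theorem prevPair_Q_lower (hσI : σI ≤ s) :
    q ^ 3 * B - 26 / 25 ≤ (2 * B + 9) * (κ * ∫ u in (0:ℝ)..σI, wp u ^ 2) := by
  obtain ⟨⟨hRc, hFc, hwpc, -⟩, hoder, hrate, -⟩ :=
    prevPair_ctx hκq hsm hBT hΛ hcont hode herr henv hini hs hT
  have hσI0 := hBT.2.1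
  have hσS : σI ∈ Icc 0 s := ⟨hσI0.le, hσI⟩
  have hxF := prevPair_xF hκq hsm hBT hΛ hcont hode herr henv hini hs hT le_rfl hσI0.le hσI
  have hV := prevPair_wp_σI hκq hsm hBT hΛ hcont hode herr henv hini hs hT hσI
  obtain ⟨hκ0, -, -, -⟩ := hκq
  obtain ⟨-, hεb, hεω, hω, -, -, -, -, -⟩ := hsm
  obtain ⟨-, -, -, hwp0l, -, -, -⟩ := hini
  have hκ : 0 < κ := by linarith
  have hen := previousPair_energy (x := wp) (R := fun u => b u / q + 1 - bp u)
    (F := fun u => κ * εb * bp u ^ 2 + e1 u) (t₀ := 0) (t₁ := s) hwpc hRc hFc hoder hσS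
  have hsub : Icc 0 σI ⊆ Icc 0 s := Icc_subset_Icc_right hσI
  have hI : IntervalIntegrable (fun u => wp u ^ 2) volume 0 σI :=
    ((hwpc.mono hsub).pow 2).intervalIntegrable_of_Icc hσI0.le
  have hmono : ∫ u in (0:ℝ)..σI, (b u / q + 1 - bp u) * wp u ^ 2 ≤
      ∫ u in (0:ℝ)..σI, (B + 9 / 2) * wp u ^ 2 :=
    intervalIntegral.integral_mono_on hσI0.le
      (((hRc.mul (hwpc.pow 2)).mono hsub).intervalIntegrable_of_Icc hσI0.le) (hI.const_mul _)
      fun u hu => mul_le_mul_of_nonneg_right (hrate u (hsub hu)).2.1 (sq_nonneg _)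
  rw [intervalIntegral.integral_const_mul] at hmono
  generalize (∫ u in (0:ℝ)..σI, wp u ^ 2) = I at hmono ⊢
  generalize (∫ u in (0:ℝ)..σI, (b u / q + 1 - bp u) * wp u ^ 2) = IR at hmono hen
  generalize (∫ u in (0:ℝ)..σI, wp u * (κ * εb * bp u ^ 2 + e1 u)) = X at hxF hen
  have h2 : q ^ 3 * B - 1 - ω ^ 2 / 100 - 3 / 100 ≤ 2 * κ * IR := by
    rw [hen]; linarith only [hwp0l, hV, (abs_le.1 hxF).1]
  have hω2 : ω ^ 2 ≤ 1 / 10000 := by nlinarith only [hω, hεb, hεω]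
  nlinarith only [mul_le_mul_of_nonneg_left hmono (by positivity : (0:ℝ) ≤ 2 * κ), h2, hω2]

/-- **Carrier after `σI`.** `bp ≤ 19/100` on `[σI, s]`: the weighted dump exceeds
`κ∫₀^{σI} wp² ≥ (q³B - 1.04)/(2B+9)`, so `bp ≤ max(0, bp(0) - κ∫₀^{σI} wp²) + 7/125`. [folklore] -/
theorem prevPair_bp_after {σ : ℝ} (hσ : σ ∈ Icc σI s) : bp σ ≤ 19 / 100 := by
  obtain ⟨⟨-, -, hwpc, -⟩, -, -, -⟩ :=
    prevPair_ctx hκq hsm hBT hΛ hcont hode herr henv hini hs hT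
  have hσI0 := hBT.2.1
  have hσIs : σI ≤ s := hσ.1.trans hσ.2
  have hσS : σ ∈ Icc 0 s := ⟨hσI0.le.trans hσ.1, hσ.2⟩
  have hD := prevPair_bp_duhamel hκq hsm hBT hΛ hcont hode herr henv hini hs hT hσS
  have hQl := prevPair_Q_lower hκq hsm hBT hΛ hcont hode herr henv hini hs hT hσIs
  obtain ⟨hκ0, -, hq1, hq2⟩ := hκq
  obtain ⟨hB, -, -, -, -⟩ := hBT
  obtain ⟨-, hbp0u, -, -, -, -, -⟩ := hini
  have hκ : 0 < κ := by linarith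
  -- `I₁(σ) ≥ κ ∫₀^σ wp² ≥ κ ∫₀^{σI} wp²`
  have hsub : Icc 0 σ ⊆ Icc 0 s := Icc_subset_Icc_right hσ.2
  have hwI : IntervalIntegrable (fun u => wp u ^ 2) volume 0 σ :=
    ((hwpc.mono hsub).pow 2).intervalIntegrable_of_Icc hσS.1
  have hmono : ∫ u in (0:ℝ)..σ, κ * wp u ^ 2 ≤
      ∫ u in (0:ℝ)..σ, Real.exp (κ * u) * (κ * wp u ^ 2) :=
    intervalIntegral.integral_mono_on hσS.1 (hwI.const_mul κ)
      (((Continuous.continuousOn (by fun_prop)).mul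
        (continuousOn_const.mul ((hwpc.mono hsub).pow 2))).intervalIntegrable_of_Icc hσS.1)
      fun u hu => by
        have hE : 1 ≤ Real.exp (κ * u) := Real.one_le_exp (mul_nonneg hκ.le hu.1)
        have := mul_le_mul_of_nonneg_right hE (mul_nonneg hκ.le (sq_nonneg (wp u)))
        linarith only [this]
  rw [intervalIntegral.integral_const_mul] at hmono
  have hwI0 : IntervalIntegrable (fun u => wp u ^ 2) volume 0 σI :=
    ((hwpc.mono (Icc_subset_Icc_right hσIs)).pow 2).intervalIntegrable_of_Icc hσI0.le
  have hsplit := intervalIntegral.integral_interval_sub_left hwI hwI0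
  have hnn : 0 ≤ ∫ u in σI..σ, wp u ^ 2 :=
    intervalIntegral.integral_nonneg hσ.1 fun u _ => sq_nonneg _
  rw [← hsplit] at hnn
  generalize (∫ u in (0:ℝ)..σ, Real.exp (κ * u) * (κ * wp u ^ 2)) = I1 at hD hmono
  generalize (∫ u in (0:ℝ)..σ, wp u ^ 2) = Iσ at hmono hnn
  generalize (∫ u in (0:ℝ)..σI, wp u ^ 2) = II at hQl hnn
  have hE := Real.exp_pos (-(κ * σ))
  have hEle : Real.exp (-(κ * σ)) ≤ 1 := Real.exp_le_one_iff.2 (by nlinarith only [hκ, hσS.1])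
  -- `bp 0 - κ II ≤ 0.131`
  have hq3 : q ^ 3 ≤ 1158 / 1000 := by nlinarith [pow_le_pow_left₀ (by linarith) hq2 3]
  have hq43 : q ^ 4 - q ^ 3 ≤ 579 / 10000 := by
    have : q ^ 4 - q ^ 3 = q ^ 3 * (q - 1) := by ring
    rw [this]; nlinarith only [hq3, hq2, hq1, pow_nonneg (by linarith only [hq1] : (0:ℝ) ≤ q) 3]
  have hq4 : q ^ 4 ≤ 194481 / 160000 := by
    have := pow_le_pow_left₀ (by linarith only [hq1]) hq2 4
    norm_num at this
    exact this
  have hkey : (2 * B + 9) * (bp 0 - κ * II) ≤ (2 * B + 9) * (134 / 1000) := by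
    nlinarith only [hQl, hbp0u, hq43, hq4, hB]
  have hkey' : bp 0 - κ * II ≤ 134 / 1000 := le_of_mul_le_mul_left hkey (by linarith only [hB])
  have h1 : Real.exp (-(κ * σ)) * (bp 0 - I1) ≤ 134 / 1000 := by
    have h2 : bp 0 - I1 ≤ 134 / 1000 := by nlinarith only [hkey', hmono, hnn, hκ]
    rcases le_or_gt 0 (bp 0 - I1) with h | h
    · nlinarith only [hEle, h, h2, hE]
    · nlinarith only [hE, h]
  linarith only [(abs_le.1 hD).2, h1]

/-- **Carrier lower bound.** `-3/10 ≤ bp` on `[0, s]`: the weighted dump is at most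
`e^{κσd} κ∫₀^{σd} wp² + e^{κσ}/125` (`σd = 30/B`), and
`(1 - 30/B) bp(0) - κ∫₀^{σd} wp² ≥ -1/5` by the dump bound. [folklore] -/
theorem prevPair_bp_lower {σ : ℝ} (hσ : σ ∈ Icc 0 s) : -(3 / 10) ≤ bp σ := by
  obtain ⟨⟨-, -, hwpc, -⟩, -, -, -⟩ :=
    prevPair_ctx hκq hsm hBT hΛ hcont hode herr henv hini hs hT
  have hD := prevPair_bp_duhamel hκq hsm hBT hΛ hcont hode herr henv hini hs hT hσ
  have hdump := fun (t : ℝ) (ht : t ∈ Icc 0 s) (htd : t ≤ 30 / B) =>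
    prevPair_Q_dump hκq hsm hBT hΛ hcont hode herr henv hini hs hT ht htd
  have htail := fun (t : ℝ) (ht : t ∈ Icc (30 / B) s) =>
    prevPair_Q_tail hκq hsm hBT hΛ hcont hode herr henv hini hs hT ht
  obtain ⟨hκ0, hκ1, hq1, hq2⟩ := hκq
  obtain ⟨hbp0l, -, -, -, -, -, -⟩ := hini
  have hB : 1000 ≤ B := hBT.1
  have hB0 : 0 < B := by linarith only [hB]
  have hd0 : (0:ℝ) ≤ 30 / B := by positivity
  have hκ : 0 < κ := by linarith
  have hq4 : q ^ 4 ≤ 194481 / 160000 := by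
    have := pow_le_pow_left₀ (by linarith only [hq1]) hq2 4
    norm_num at this
    exact this
  have hbp0 : 0 ≤ bp 0 := by nlinarith only [hbp0l, one_le_pow₀ (M₀ := ℝ) hq1 (n := 4)]
  -- the numerical core
  have hcore : ∀ Qd : ℝ, (B - 33) * Qd ≤ q ^ 4 * (B + 2) / 2 →
      -(1 / 5) ≤ (1 - 30 / B) * bp 0 - Qd := by
    intro Qd hQd
    have e : (B - 33) * (1 - 30 / B) = B - 63 + 990 / B := by field_simp; ring
    have h990 : 0 ≤ 990 / B := by positivity
    have h1 : (B - 63) * (q ^ 4 / 2 - 3 / 20) ≤ (B - 63) * bp 0 :=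
      mul_le_mul_of_nonneg_left hbp0l (by linarith only [hB])
    have h2 : (B - 63) * bp 0 ≤ (B - 33) * (1 - 30 / B) * bp 0 := by
      rw [e]; nlinarith only [h990, hbp0]
    have key : (B - 33) * (-(1 / 5)) ≤ (B - 33) * ((1 - 30 / B) * bp 0 - Qd) := by
      nlinarith only [h1, h2, hQd, hq4, hB]
    exact le_of_mul_le_mul_left key (by linarith only [hB])
  -- the head of the weighted dump: `∫_{0}^{t} e^{κu} κ wp² ≤ e^{κt} κ∫₀^t wp²`
  have hhead : ∀ t ∈ Icc 0 s, ∫ u in (0:ℝ)..t, Real.exp (κ * u) * (κ * wp u ^ 2) ≤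
      Real.exp (κ * t) * (κ * ∫ u in (0:ℝ)..t, wp u ^ 2) := by
    intro t ht
    have hsub : Icc 0 t ⊆ Icc 0 s := Icc_subset_Icc_right ht.2
    have hwI : IntervalIntegrable (fun u => wp u ^ 2) volume 0 t :=
      ((hwpc.mono hsub).pow 2).intervalIntegrable_of_Icc ht.1
    have hm : ∫ u in (0:ℝ)..t, Real.exp (κ * u) * (κ * wp u ^ 2) ≤
        ∫ u in (0:ℝ)..t, Real.exp (κ * t) * (κ * wp u ^ 2) :=
      intervalIntegral.integral_mono_on ht.1
        (((Continuous.continuousOn (by fun_prop)).mul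
          (continuousOn_const.mul ((hwpc.mono hsub).pow 2))).intervalIntegrable_of_Icc ht.1)
        ((hwI.const_mul κ).const_mul _) fun u hu =>
          mul_le_mul_of_nonneg_right (Real.exp_le_exp.2 (mul_le_mul_of_nonneg_left hu.2 hκ.le))
            (mul_nonneg hκ.le (sq_nonneg _))
    rwa [intervalIntegral.integral_const_mul, intervalIntegral.integral_const_mul] at hm
  have hE := Real.exp_pos (-(κ * σ))
  rcases le_or_gt σ (30 / B) with hσd | hσd
  · -- during the dump
    have h1 := hhead σ hσ
    have h2 := hcore _ (hdump σ hσ hσd)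
    generalize (∫ u in (0:ℝ)..σ, Real.exp (κ * u) * (κ * wp u ^ 2)) = I1 at hD h1
    generalize κ * ∫ u in (0:ℝ)..σ, wp u ^ 2 = Qσ at h1 h2
    have hEE : Real.exp (-(κ * σ)) * Real.exp (κ * σ) = 1 := by
      rw [← Real.exp_add, neg_add_cancel, Real.exp_zero]
    have hElo : 1 - 30 / B ≤ Real.exp (-(κ * σ)) := by
      have := Real.one_sub_le_exp_neg (κ * σ)
      nlinarith only [this, hσd, hκ1, hσ.1]
    have h3 : Real.exp (-(κ * σ)) * (bp 0 - I1) ≥ (1 - 30 / B) * bp 0 - Qσ := by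
      have := mul_le_mul_of_nonneg_left h1 hE.le
      rw [← mul_assoc, hEE, one_mul] at this
      nlinarith only [this, hElo, hbp0]
    linarith only [(abs_le.1 hD).1, h2, h3]
  · -- after the dump: split the weighted dump at `σd = 30/B`
    have hsd : 30 / B ≤ s := hσd.le.trans hσ.2
    have h1 := hhead (30 / B) ⟨hd0, hsd⟩
    have h2 := hcore _ (hdump (30 / B) ⟨hd0, hsd⟩ le_rfl)
    have h3 := htail σ ⟨hσd.le, hσ.2⟩
    have hsub : Icc 0 σ ⊆ Icc 0 s := Icc_subset_Icc_right hσ.2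
    have hfc : ContinuousOn (fun u => Real.exp (κ * u) * (κ * wp u ^ 2)) (Icc 0 σ) :=
      (Continuous.continuousOn (by fun_prop)).mul (continuousOn_const.mul ((hwpc.mono hsub).pow 2))
    have hIa : IntervalIntegrable (fun u => Real.exp (κ * u) * (κ * wp u ^ 2)) volume 0 (30 / B) :=
      (hfc.mono (Icc_subset_Icc_right hσd.le)).intervalIntegrable_of_Icc hd0
    have hIb : IntervalIntegrable (fun u => Real.exp (κ * u) * (κ * wp u ^ 2)) volume (30 / B) σ :=
      (hfc.mono (Icc_subset_Icc_left hd0)).intervalIntegrable_of_Icc hσd.le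
    have hsplit := intervalIntegral.integral_add_adjacent_intervals hIa hIb
    -- the tail of the weighted dump
    have hwIb : IntervalIntegrable (fun u => wp u ^ 2) volume (30 / B) σ :=
      ((hwpc.mono fun u hu => ⟨hd0.trans hu.1, hu.2.trans hσ.2⟩).pow 2).intervalIntegrable_of_Icc
        hσd.le
    have h4 : ∫ u in (30 / B)..σ, Real.exp (κ * u) * (κ * wp u ^ 2) ≤
        Real.exp (κ * σ) * (κ * ∫ u in (30 / B)..σ, wp u ^ 2) := by
      have hm : ∫ u in (30 / B)..σ, Real.exp (κ * u) * (κ * wp u ^ 2) ≤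
          ∫ u in (30 / B)..σ, Real.exp (κ * σ) * (κ * wp u ^ 2) :=
        intervalIntegral.integral_mono_on hσd.le hIb ((hwIb.const_mul κ).const_mul _)
          fun u hu => mul_le_mul_of_nonneg_right
            (Real.exp_le_exp.2 (mul_le_mul_of_nonneg_left hu.2 hκ.le))
            (mul_nonneg hκ.le (sq_nonneg _))
      rwa [intervalIntegral.integral_const_mul, intervalIntegral.integral_const_mul] at hm
    rw [← hsplit] at hD
    generalize (∫ u in (0:ℝ)..(30 / B), Real.exp (κ * u) * (κ * wp u ^ 2)) = Ia at hD h1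
    generalize (∫ u in (30 / B)..σ, Real.exp (κ * u) * (κ * wp u ^ 2)) = Ib at hD h4
    generalize κ * ∫ u in (0:ℝ)..(30 / B), wp u ^ 2 = Qd at h1 h2
    generalize κ * ∫ u in (30 / B)..σ, wp u ^ 2 = Qt at h3 h4
    have hEE : Real.exp (-(κ * σ)) * Real.exp (κ * σ) = 1 := by
      rw [← Real.exp_add, neg_add_cancel, Real.exp_zero]
    have hE1 : Real.exp (-(κ * σ)) * Real.exp (κ * (30 / B)) =
        Real.exp (-(κ * (σ - 30 / B))) := by rw [← Real.exp_add]; ring_nf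
    have hE1le : Real.exp (-(κ * (σ - 30 / B))) ≤ 1 :=
      Real.exp_le_one_iff.2 (by nlinarith only [hκ, hσd])
    have hE1pos := Real.exp_pos (-(κ * (σ - 30 / B)))
    have hEd : 1 - 30 / B ≤ Real.exp (-(κ * (30 / B))) := by
      have := Real.one_sub_le_exp_neg (κ * (30 / B))
      nlinarith only [this, hκ1, hd0]
    have hEσ : Real.exp (-(κ * σ)) = Real.exp (-(κ * (σ - 30 / B))) * Real.exp (-(κ * (30 / B))) := by
      rw [← Real.exp_add]; ring_nf
    -- `e^{-κσ} bp0 - e^{-κ(σ-σd)} Qd ≥ -1/5`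
    have h5 : -(1 / 5) ≤ Real.exp (-(κ * σ)) * bp 0 - Real.exp (-(κ * (σ - 30 / B))) * Qd := by
      rw [hEσ]
      have hX : Real.exp (-(κ * (σ - 30 / B))) * Real.exp (-(κ * (30 / B))) * bp 0 -
          Real.exp (-(κ * (σ - 30 / B))) * Qd ≥
          Real.exp (-(κ * (σ - 30 / B))) * ((1 - 30 / B) * bp 0 - Qd) := by
        nlinarith only [mul_le_mul_of_nonneg_left (mul_le_mul_of_nonneg_right hEd hbp0) hE1pos.le]
      rcases le_or_gt 0 ((1 - 30 / B) * bp 0 - Qd) with h | h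
      · nlinarith only [hX, h, hE1pos]
      · nlinarith only [hX, h, hE1le, h2]
    have h6 : Real.exp (-(κ * σ)) * (bp 0 - (Ia + Ib)) ≥
        Real.exp (-(κ * σ)) * bp 0 - Real.exp (-(κ * (σ - 30 / B))) * Qd - Qt := by
      have ha := mul_le_mul_of_nonneg_left h1 hE.le
      have hb := mul_le_mul_of_nonneg_left h4 hE.le
      rw [← mul_assoc, hE1] at ha
      rw [← mul_assoc, hEE, one_mul] at hb
      nlinarith only [ha, hb]
    linarith only [(abs_le.1 hD).1, h5, h6, h3]

/-- **The spent bond after `σI` (sharp).** `wp² ≤ ω²/4` on `[σI, s]`: restart at `σI` with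
`wp(σI)² ≤ ω²/100`, rate `R ≥ 31/100` (`bp ≤ 19/100`, `b ≥ -1/2`) and forcing
`|F| ≤ κ(εb · 9/100 + ω/10) ≤ (9ω/25) κ R`. [folklore] -/
theorem prevPair_wp_after {σ : ℝ} (hσ : σ ∈ Icc σI s) : wp σ ^ 2 ≤ ω ^ 2 / 4 := by
  have hσI0 := hBT.2.1
  have hσIs : σI ≤ s := hσ.1.trans hσ.2
  have hV := prevPair_wp_σI hκq hsm hBT hΛ hcont hode herr henv hini hs hT hσIs
  obtain ⟨⟨hRc, -, hwpc, -⟩, hoder, -, -⟩ :=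
    prevPair_ctx hκq hsm hBT hΛ hcont hode herr henv hini hs hT
  have hafter := fun (t : ℝ) (ht : t ∈ Icc σI s) =>
    prevPair_bp_after hκq hsm hBT hΛ hcont hode herr henv hini hs hT ht
  have hlower := fun (t : ℝ) (ht : t ∈ Icc 0 s) =>
    prevPair_bp_lower hκq hsm hBT hΛ hcont hode herr henv hini hs hT ht
  have hm1 := fun (t : ℝ) (ht : t ∈ Icc 0 s) =>
    prevPair_m1 hκq hsm hBT hΛ hcont hode herr henv hini hs hT ht
  obtain ⟨hκ0, -, hq1, -⟩ := hκq
  obtain ⟨hη, hεb, hεω, -, hμ, hημB, -, -, -⟩ := hsm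
  obtain ⟨-, he1, -, -⟩ := herr
  obtain ⟨-, -, hb⟩ := henv
  have hκ : 0 < κ := by linarith
  have hq0 : 0 < q := by linarith
  have hω0 : 0 ≤ ω := by linarith
  have hsub : Icc σI s ⊆ Icc 0 s := Icc_subset_Icc_left hσI0.le
  have hRlo : ∀ t ∈ Icc σI s, 31 / 100 ≤ b t / q + 1 - bp t := by
    intro t ht
    have h1 := hafter t ht
    have h2 := (hb t ⟨hσI0.le.trans ht.1, ht.2.trans hs.2⟩).1
    have : -(1 / 2) ≤ b t / q := by rw [le_div_iff₀ hq0]; nlinarith only [h2, hq1]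
    linarith only [this, h1]
  have hFR : ∀ t ∈ Icc σI s, |κ * εb * bp t ^ 2 + e1 t| ≤
      9 * ω / 25 * (κ * (b t / q + 1 - bp t)) := by
    intro t ht
    have htS := hsub ht
    have h1 := hafter t ht
    have h2 := hlower t htS
    have h3 := hm1 t htS
    have hbp2 : bp t ^ 2 ≤ 9 / 100 := by nlinarith only [h1, h2]
    have h4 : |κ * εb * bp t ^ 2| ≤ κ * (ω / 10) * (9 / 100) := by
      rw [abs_of_nonneg (by positivity)]
      have : εb * bp t ^ 2 ≤ ω / 10 * (9 / 100) :=
        mul_le_mul (by linarith only [hεω]) hbp2 (sq_nonneg _) (by linarith only [hω0])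
      nlinarith only [this, hκ]
    have h5 : |e1 t| ≤ κ * (ω / 10) := by
      refine (he1 t ⟨htS.1, htS.2.trans hs.2⟩).trans ?_
      have h6 : η * m1 t ≤ η * (μ + 2 * Real.sqrt B) := mul_le_mul_of_nonneg_left h3 hη
      have h7 : η * κ * m1 t = κ * (η * m1 t) := by ring
      rw [h7]
      exact mul_le_mul_of_nonneg_left (h6.trans hημB) hκ.le
    have h8 : 0 ≤ κ * ω * (b t / q + 1 - bp t - 31 / 100) :=
      mul_nonneg (mul_nonneg hκ.le hω0) (by linarith only [hRlo t ht])
    calc _ ≤ |κ * εb * bp t ^ 2| + |e1 t| := abs_add_le _ _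
      _ ≤ κ * (ω / 10) * (9 / 100) + κ * (ω / 10) := add_le_add h4 h5
      _ ≤ _ := by nlinarith only [h8, mul_nonneg hκ.le hω0]
  have h := previousPair_sq_le (x := wp) (R := fun u => b u / q + 1 - bp u)
    (F := fun u => κ * εb * bp u ^ 2 + e1 u) hσIs hκ (hwpc.mono hsub) (hRc.mono hsub)
    (fun t ht => hoder t ⟨hσI0.trans ht.1, ht.2⟩)
    (fun t ht => by linarith only [hRlo t ht]) hFR hσ
  have hI : 0 ≤ ∫ u in σI..σ, (b u / q + 1 - bp u) :=
    intervalIntegral.integral_nonneg hσ.1 fun u hu => by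
      linarith only [hRlo u ⟨hu.1, hu.2.trans hσ.2⟩]
  have hE : Real.exp (-(κ * ∫ u in σI..σ, (b u / q + 1 - bp u))) ≤ 1 :=
    Real.exp_le_one_iff.2 (by nlinarith only [hI, hκ])
  nlinarith only [h, hE, hV, sq_nonneg (wp σI), sq_nonneg ω,
    Real.exp_pos (-(κ * ∫ u in σI..σ, (b u / q + 1 - bp u)))]

end Tube

/-- **Registered sub-goal `stub_prevPairRelax`** (stub `previousPair`, line `Sketch`):
inside the bootstrap tube on `[0, s]`, the spent bond obeys the SHARP bound `wp² ≤ ω²/4` on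
`[σI, s]`. [folklore] -/
theorem stub_prevPairRelax :
    ∀ (bp wp b m0 m1 wl e0 e1 : ℝ → ℝ) (B Λ κ q θ η εb ω μ σI T s : ℝ),
      (4 / 5 ≤ κ ∧ κ ≤ 1 ∧ 1 ≤ q ∧ q ≤ 21 / 20) →
      (0 ≤ η ∧ 0 < εb ∧ 10 * εb ≤ ω ∧ ω ≤ 1 / 100 ∧ 0 ≤ μ ∧
        η * (μ + 2 * Real.sqrt B) ≤ ω / 10 ∧ η * μ ≤ 1 / 20 ∧ 1 / 2 ≤ θ ∧ θ ≤ 1) →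
      (1000 ≤ B ∧ 0 < σI ∧ σI ≤ 3 ∧ 0 < T ∧ T ≤ 10) →
      (100 ≤ Λ ∧ Λ ≤ B * (1 - Real.exp (-σI)) ∧
        11 * Real.sqrt B * Real.exp (-(κ * Λ / 3)) ≤ ω) →
      (ContinuousOn bp (Icc 0 T) ∧ ContinuousOn wp (Icc 0 T) ∧ ContinuousOn b (Icc 0 T) ∧
        ContinuousOn m0 (Icc 0 T) ∧ ContinuousOn m1 (Icc 0 T) ∧ ContinuousOn wl (Icc 0 T) ∧
        ContinuousOn e0 (Icc 0 T) ∧ ContinuousOn e1 (Icc 0 T)) →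
      ((∀ σ ∈ Ioo 0 T, HasDerivAt bp
          (κ * (-(bp σ) - (wp σ) ^ 2 + (wl σ) ^ 2 - εb * bp σ * wp σ) + e0 σ) σ) ∧
        (∀ σ ∈ Ioo 0 T, HasDerivAt wp
          (κ * (wp σ * (bp σ - b σ / q - 1) + εb * (bp σ) ^ 2) + e1 σ) σ)) →
      ((∀ σ ∈ Icc 0 T, |e0 σ| ≤ η * κ * m0 σ) ∧ (∀ σ ∈ Icc 0 T, |e1 σ| ≤ η * κ * m1 σ) ∧
        (∀ σ ∈ Icc 0 T, 0 ≤ m0 σ ∧ m0 σ ≤ m0 0 * Real.exp (-(θ * κ * σ)) +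
          κ * ∫ u in (0 : ℝ)..σ, Real.exp (-(θ * κ * (σ - u))) *
            |-(wp u) ^ 2 + (wl u) ^ 2 - εb * bp u * wp u|) ∧
        (∀ σ ∈ Icc 0 T, 0 ≤ m1 σ ∧ m1 σ ≤ m1 0 * Real.exp (-(θ * κ * σ)) +
          κ * ∫ u in (0 : ℝ)..σ, Real.exp (-(θ * κ * (σ - u))) *
            |wp u * (bp u - b u / q) + εb * (bp u) ^ 2|)) →
      ((∀ σ ∈ Icc 0 T, |wl σ| ≤ ω) ∧
        (∀ σ ∈ Icc 0 (min T σI), B * Real.exp (-σ) - 3 ≤ b σ) ∧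
        (∀ σ ∈ Icc 0 T, -(1 / 2) ≤ b σ ∧ b σ ≤ B + 3)) →
      (q ^ 4 / 2 - 3 / 20 ≤ bp 0 ∧ bp 0 ≤ q ^ 4 / 2 + 1 / 10 ∧ 0 ≤ wp 0 ∧
        q ^ 3 * B - 1 ≤ (wp 0) ^ 2 ∧ (wp 0) ^ 2 ≤ q ^ 3 * B + 1 ∧ m0 0 ≤ μ ∧ m1 0 ≤ μ) →
      (s ∈ Icc 0 T) →
      (∀ σ ∈ Icc 0 s, -(1 / 2) ≤ bp σ ∧ bp σ ≤ 9 / 10 ∧ (σ ≤ σI ∨ bp σ ≤ 2 / 5) ∧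
        m1 σ ≤ μ + 3 * Real.sqrt B ∧ κ * ∫ u in (0 : ℝ)..σ, (wp u) ^ 2 ≤ 1) →
      ∀ σ ∈ Icc σI s, wp σ ^ 2 ≤ ω ^ 2 / 4 :=
  fun _ _ _ _ _ _ _ _ _ _ _ _ _ _ _ _ _ _ _ _ hκq hsm hBT hΛ hcont hode herr henv hini hs hT _ hσ =>
    prevPair_wp_after hκq hsm hBT hΛ hcont hode herr henv hini hs hT hσ

end Summit.NavierStokesRegularity.NavierStokesRegularity.Theorems.PerpetualPumpAveragedTypeIBlowup

end
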